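import Summits.Ventures.LatticeQCDFlow.Scaling.DominatedStarMinorization

/-!
HONEST FRAMING: exact (Metropolis-corrected) sampling algorithms for lattice gauge theory; figures
of merit are autocorrelation/cost numbers at stated couplings and volumes; no continuum-physics
claim.

# WarmStartAugmentation — THE REGENERATION ARGUMENT FROM A FRESH INITIAL LAW: FOR THE MAP-ASSISTED HOT-REFRESHED HUB,
# ANY INITIAL AUGMENTED LAW `Λ₀(z, D)` THAT IS FRESH (EVERY COORDINATE OUTSIDE ITS STALE SET EXACTLY DISTRIBUTED GIVEN THE
# REST) GIVES `‖λ₀Pⁿ − π̃‖_TV ≤ Σ_{D ≠ ∅}(ν₀Qⁿ)(D)` WITH `λ₀`, `ν₀` ITS TWO MARGINALS, AND FROM A STALE SET `D₀` THE TAG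
# CHAIN HAS `Σ_{D≠∅}(δ_{D₀}Qⁿ)(D) ≤ (1−ρ)ⁿ·Φ_b(D₀)/b`, `Φ_b(D₀) = b·𝟙{0 ∈ D₀} + #(D₀ ∖ {0})` (lean-2 GEN-26, ours)

Venture-side (OURS).  Cell `lqcd-flow` (pub-lqcd), unit `pub-lqcd-lean-2-g26`, 2026-08-27.  Chapter M, file 23.  Chapter M
ran the augmented chain `P̂` of `Scaling/DominatedStarAugmentation` from `δ_{(x, univ)}` (every replica stale).  Its
one-step lemmas (`dom_lump_fst`, `dom_fresh_step`, `dom_tag_step`, `regen_step_potential_le`) are statements about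
arbitrary laws, so the whole argument runs from any FRESH initial augmented law — the situation after a perturbation of
an equilibrated run, where only the perturbed replicas are stale.  This file records that generality; the sequel
(`Scaling/WarmStartCeiling`) instantiates it.

## What is proved

* §1 **`regen_nonempty_le_from`** — the tag chain `Q` from `δ_{D₀}` under the three drift conditions of
  `RegenerationTagChain.regen_nonempty_le`: `Σ_{D≠∅}(δ_{D₀}Qⁿ)(D) ≤ (1−ρ)ⁿ·Φ_b(D₀)/b`.
* §2 from a fresh, non-negative initial augmented law `Λ₀`: **`dom_fresh_lawAt_of`** (freshness at all times),
  **`dom_lawAt_fst_of`** (configuration marginal `= λ₀Pⁿ`), **`dom_lawAt_snd_of`** (tag marginal `= ν₀Qⁿ`),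
  **`dom_lawAt_empty_eq_of`** (`Λ_n(z, ∅) = (ν₀Qⁿ)(∅)·π̃(z)` when `Σ Λ₀ = 1`), **`dom_minorization_of`**
  (`(λ₀Pⁿ)(z) ≥ (ν₀Qⁿ)(∅)·π̃(z)`), **`dom_tvDist_le_stale_of`** (`‖λ₀Pⁿ − π̃‖_TV ≤ Σ_{D≠∅}(ν₀Qⁿ)(D)`).

NOT CLAIMED: anything beyond the book-keeping generalisation; anything measured.  Literature grade (cell rule): OWN
RESULT; nothing cited as a fact; no new bib keys.
-/

noncomputable section

open Finset Function
open Literature.Probability.MarkovChains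

namespace Summit.Ventures.LatticeQCDFlow.Scaling

variable {S : Type*} [Fintype S] [DecidableEq S] {K m : ℕ} {μ : Fin (K + 1) → S → ℝ} {M : Fin (K + 1) → S → S → ℝ}
  {w : Fin (K + 1) → ℝ} {t p q : ℝ}

section Warm
variable (κ : Fin m → Fin K) (φ : Fin m → Equiv.Perm S)

/-! ## §1 The tag chain from an arbitrary stale set -/

/-- **THE TAG DECAY FROM `δ_{D₀}`:** under the three drift conditions (`0 < b ≤ p`, `ρ ≤ 1`, `ρ ≤ tc(p−b)/m`,
`ρb ≤ (1−t)w_0·b − t(1−qb)`, `ρ ≤ t(1−qb)c/m`): **`Σ_{D≠∅}(δ_{D₀}Qⁿ)(D) ≤ (1−ρ)ⁿ·Φ_b(D₀)/b`** with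
`Φ_b(D₀) = Σ_{k∈D₀}(b if k = 0, else 1)`. [ours] -/
theorem regen_nonempty_le_from (hm : 1 ≤ m) (ht0 : 0 ≤ t) (ht1 : t ≤ 1) (hw0 : 0 ≤ w 0) (hw1 : w 0 ≤ 1)
    (hp1 : p ≤ 1) (hq0 : 0 ≤ q) (hq1 : q ≤ 1)
    {gbar : Fin m → Finset (Fin (K + 1)) → ℝ}
    (hg : ∀ r D, gbar r D = if (0 : Fin (K + 1)) ∉ D then (if (κ r).succ ∉ D then (1 : ℝ) else p)
      else (if (κ r).succ ∉ D then q else 0))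
    {Bset : Fin m → Finset (Fin (K + 1)) → Finset (Fin (K + 1))}
    (hB : ∀ r D, Bset r D = if (0 : Fin (K + 1)) ∉ D ∧ (κ r).succ ∉ D then D
      else insert (0 : Fin (K + 1)) (insert (κ r).succ D))
    {Q : Finset (Fin (K + 1)) → Finset (Fin (K + 1)) → ℝ}
    (hQ : ∀ D D', Q D D' = ∑ r : Fin m, t / m *
        (gbar r D * (if D' = D.image (Equiv.swap (0 : Fin (K + 1)) (κ r).succ) then (1 : ℝ) else 0)
          + (1 - gbar r D) * (if D' = Bset r D then (1 : ℝ) else 0))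
      + (1 - t) * (w 0 * (if D' = D.erase 0 then (1 : ℝ) else 0) + (1 - w 0) * (if D' = D then (1 : ℝ) else 0)))
    {c : ℕ} (hc : ∀ p' : Fin K, c ≤ (univ.filter (fun r : Fin m => κ r = p')).card)
    {b ρ : ℝ} (hb0 : 0 < b) (hbp : b ≤ p) (hρ1 : ρ ≤ 1) (h1 : ρ ≤ t * c * (p - b) / m)
    (h2 : ρ * b ≤ (1 - t) * w 0 * b - t * (1 - q * b)) (h3 : ρ ≤ t * (1 - q * b) * c / m)
    (D₀ : Finset (Fin (K + 1))) (n : ℕ) :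
    ∑ D ∈ univ.filter (fun D : Finset (Fin (K + 1)) => D ≠ ∅), lawAt Q (Pi.single D₀ 1) n D
      ≤ (1 - ρ) ^ n * (∑ k ∈ D₀, (if k = (0 : Fin (K + 1)) then b else 1)) / b := by
  have hp0 : 0 ≤ p := hb0.le.trans hbp
  have hb1 : b ≤ 1 := hbp.trans hp1
  have hqb : q * b ≤ 1 := by nlinarith
  set ρ' := lawAt Q (Pi.single D₀ 1) n with hρ'
  have hQst := regen_isRowStochastic κ hm ht0 ht1 hw0 hw1 hp0 hp1 hq0 hq1 hg hQ
  have hρ'0 : ∀ D, 0 ≤ ρ' D := fun D => lawAt_nonneg hQst (fun U => by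
    by_cases h : U = D₀
    · subst h; rw [Pi.single_eq_same]; norm_num
    · rw [Pi.single_eq_of_ne h]) n D
  have hΦge : ∀ D : Finset (Fin (K + 1)), b * (if D ≠ ∅ then (1 : ℝ) else 0)
      ≤ ∑ k ∈ D, (if k = (0 : Fin (K + 1)) then b else 1) := by
    intro D
    split_ifs with hD
    · obtain ⟨k, hk⟩ := Finset.nonempty_iff_ne_empty.mpr hD
      rw [mul_one]
      refine le_trans ?_ (Finset.single_le_sum (f := fun k => if k = (0 : Fin (K + 1)) then b else (1 : ℝ))
        (fun j _ => by split_ifs <;> linarith) hk)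
      split_ifs <;> linarith
    · rw [mul_zero]; exact sum_nonneg fun j _ => by split_ifs <;> linarith
  have hdecay := lawMean_lawAt_le_of_step_le hQst (by linarith : (0 : ℝ) ≤ 1 - ρ)
    (regen_step_potential_le κ hm ht0 hg hB hQ hc hbp hqb h1 h2 h3)
    (μ := Pi.single D₀ 1) (fun U => by
      by_cases h : U = D₀
      · subst h; rw [Pi.single_eq_same]; norm_num
      · rw [Pi.single_eq_of_ne h]) n
  rw [lawMean_single] at hdecay
  have hmass : b * ∑ D ∈ univ.filter (fun D : Finset (Fin (K + 1)) => D ≠ ∅), ρ' D ≤ lawMean ρ'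
      (fun D => ∑ k ∈ D, (if k = (0 : Fin (K + 1)) then b else 1)) := by
    unfold lawMean
    rw [Finset.sum_filter, mul_sum]
    refine sum_le_sum fun D _ => ?_
    have := mul_le_mul_of_nonneg_left (hΦge D) (hρ'0 D)
    calc b * (if D ≠ ∅ then ρ' D else 0) = ρ' D * (b * if D ≠ ∅ then (1 : ℝ) else 0) := by split_ifs <;> ring
      _ ≤ ρ' D * ∑ k ∈ D, (if k = (0 : Fin (K + 1)) then b else 1) := this
  rw [le_div_iff₀ hb0]
  linarith

/-! ## §2 The augmented chain from a fresh initial law -/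

/-- **FRESHNESS PROPAGATES FROM ANY FRESH INITIAL LAW** (exact hot sampler, stationary cold kernels). [ours] -/
theorem dom_fresh_lawAt_of (hμ : ∀ k x, 0 < μ k x) (hM0 : ∀ u v, M 0 u v = μ 0 v)
    (hstat : ∀ k : Fin (K + 1), k ≠ 0 → ∀ v, ∑ u, μ k u * M k u v = μ k v)
    {α : Fin m → (Fin (K + 1) → S) → ℝ}
    (hα : ∀ r z, α r z = min 1 (tensorFun μ (edgeFlowSwap (φ r) 0 (κ r).succ z) / tensorFun μ z))
    {β : Fin m → (Fin (K + 1) → S) → ℝ} (hβ : ∀ r z, β r z = p * μ (κ r).succ (φ r (z 0)) / μ 0 (z 0))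
    {β' : Fin m → (Fin (K + 1) → S) → ℝ}
    (hβ' : ∀ r z, β' r z = q * μ 0 ((φ r).symm (z (κ r).succ)) / μ (κ r).succ (z (κ r).succ))
    {γ : Fin m → (Fin (K + 1) → S) × Finset (Fin (K + 1)) → ℝ}
    (hγ : ∀ r a, γ r a = if (0 : Fin (K + 1)) ∉ a.2 then (if (κ r).succ ∉ a.2 then α r a.1 else β r a.1)
      else (if (κ r).succ ∉ a.2 then β' r a.1 else 0))
    {Bset : Fin m → Finset (Fin (K + 1)) → Finset (Fin (K + 1))}
    (hB : ∀ r D, Bset r D = if (0 : Fin (K + 1)) ∉ D ∧ (κ r).succ ∉ D then D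
      else insert (0 : Fin (K + 1)) (insert (κ r).succ D))
    {Ph : (Fin (K + 1) → S) × Finset (Fin (K + 1)) → (Fin (K + 1) → S) × Finset (Fin (K + 1)) → ℝ}
    (hPh : ∀ a b, Ph a b = ∑ r : Fin m, t / m *
        (γ r a * (if b.1 = edgeFlowSwap (φ r) 0 (κ r).succ a.1 ∧ b.2 = a.2.image (Equiv.swap (0 : Fin (K + 1)) (κ r).succ)
            then (1 : ℝ) else 0)
          + (α r a.1 - γ r a) * (if b.1 = edgeFlowSwap (φ r) 0 (κ r).succ a.1 ∧ b.2 = Bset r a.2 then (1 : ℝ) else 0)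
          + (1 - α r a.1) * (if b.1 = a.1 ∧ b.2 = Bset r a.2 then (1 : ℝ) else 0))
      + (1 - t) * ∑ k : Fin (K + 1), w k * (coordKernel M k a.1 b.1
          * (if b.2 = (if k = 0 then a.2.erase 0 else a.2) then (1 : ℝ) else 0)))
    {Λ₀ : (Fin (K + 1) → S) × Finset (Fin (K + 1)) → ℝ}
    (hfresh : ∀ (z : Fin (K + 1) → S) (D : Finset (Fin (K + 1))) (j : Fin (K + 1)) (v : S), j ∉ D →
      Λ₀ (update z j v, D) * μ j (z j) = Λ₀ (z, D) * μ j v)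
    (n : ℕ) :
    ∀ (z : Fin (K + 1) → S) (D : Finset (Fin (K + 1))) (j : Fin (K + 1)) (v : S), j ∉ D →
      lawAt Ph Λ₀ n (update z j v, D) * μ j (z j) = lawAt Ph Λ₀ n (z, D) * μ j v := by
  induction n with
  | zero => intro z D j v hj; rw [lawAt_zero]; exact hfresh z D j v hj
  | succ n ih =>
    intro z D j v hj
    rw [lawAt_succ]
    exact dom_fresh_step κ φ hμ hM0 hstat hα hβ hβ' hγ hB hPh ih z D j v hj

/-- **THE CONFIGURATION MARGINAL FROM ANY INITIAL LAW: `Σ_D Λ_n(z, D) = (λ₀Pⁿ)(z)`**, `λ₀(z) = Σ_D Λ₀(z, D)`. [ours] -/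
theorem dom_lawAt_fst_of (hm : 1 ≤ m) (hμ : ∀ k x, 0 < μ k x)
    {α : Fin m → (Fin (K + 1) → S) → ℝ}
    (hα : ∀ r z, α r z = min 1 (tensorFun μ (edgeFlowSwap (φ r) 0 (κ r).succ z) / tensorFun μ z))
    {γ : Fin m → (Fin (K + 1) → S) × Finset (Fin (K + 1)) → ℝ}
    {Bset : Fin m → Finset (Fin (K + 1)) → Finset (Fin (K + 1))}
    {Ph : (Fin (K + 1) → S) × Finset (Fin (K + 1)) → (Fin (K + 1) → S) × Finset (Fin (K + 1)) → ℝ}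
    (hPh : ∀ a b, Ph a b = ∑ r : Fin m, t / m *
        (γ r a * (if b.1 = edgeFlowSwap (φ r) 0 (κ r).succ a.1 ∧ b.2 = a.2.image (Equiv.swap (0 : Fin (K + 1)) (κ r).succ)
            then (1 : ℝ) else 0)
          + (α r a.1 - γ r a) * (if b.1 = edgeFlowSwap (φ r) 0 (κ r).succ a.1 ∧ b.2 = Bset r a.2 then (1 : ℝ) else 0)
          + (1 - α r a.1) * (if b.1 = a.1 ∧ b.2 = Bset r a.2 then (1 : ℝ) else 0))
      + (1 - t) * ∑ k : Fin (K + 1), w k * (coordKernel M k a.1 b.1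
          * (if b.2 = (if k = 0 then a.2.erase 0 else a.2) then (1 : ℝ) else 0)))
    (Λ₀ : (Fin (K + 1) → S) × Finset (Fin (K + 1)) → ℝ) (n : ℕ) (z : Fin (K + 1) → S) :
    ∑ D, lawAt Ph Λ₀ n (z, D) = lawAt (fun y z : Fin (K + 1) → S =>
        t * ptGraphSwap μ (fun r : Fin m => (((0 : Fin (K + 1)), (κ r).succ) : Fin (K + 1) × Fin (K + 1))) φ y z
          + (1 - t) * prodKernel w M y z) (fun z' => ∑ D, Λ₀ (z', D)) n z := by
  rw [← sum_filter_prodFst_eq (fun b => lawAt Ph Λ₀ n b) z,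
    LevinPeres2017_lemma_2_5_lawAt (P := Ph) (proj := Prod.fst)
      (Ps := fun y z : Fin (K + 1) → S =>
          t * ptGraphSwap μ (fun r : Fin m => (((0 : Fin (K + 1)), (κ r).succ) : Fin (K + 1) × Fin (K + 1))) φ y z
          + (1 - t) * prodKernel w M y z)
      (fun a z' => dom_lump_fst κ φ hm hμ hα hPh a z')]
  congr 1
  funext z'
  exact sum_filter_prodFst_eq (fun b => Λ₀ b) z'

/-- **THE TAG MARGINAL FROM A FRESH INITIAL LAW: `Σ_z Λ_n(z, D) = (ν₀Qⁿ)(D)`**, `ν₀(D) = Σ_z Λ₀(z, D)`. [ours] -/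
theorem dom_lawAt_snd_of (hμ : ∀ k x, 0 < μ k x) (hμ1 : ∀ k, ∑ u, μ k u = 1) (hM : ∀ k, IsRowStochastic (M k))
    (hM0 : ∀ u v, M 0 u v = μ 0 v) (hstat : ∀ k : Fin (K + 1), k ≠ 0 → ∀ v, ∑ u, μ k u * M k u v = μ k v)
    (hw1 : ∑ k, w k = 1)
    {α : Fin m → (Fin (K + 1) → S) → ℝ}
    (hα : ∀ r z, α r z = min 1 (tensorFun μ (edgeFlowSwap (φ r) 0 (κ r).succ z) / tensorFun μ z))
    {β : Fin m → (Fin (K + 1) → S) → ℝ} (hβ : ∀ r z, β r z = p * μ (κ r).succ (φ r (z 0)) / μ 0 (z 0))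
    {β' : Fin m → (Fin (K + 1) → S) → ℝ}
    (hβ' : ∀ r z, β' r z = q * μ 0 ((φ r).symm (z (κ r).succ)) / μ (κ r).succ (z (κ r).succ))
    {γ : Fin m → (Fin (K + 1) → S) × Finset (Fin (K + 1)) → ℝ}
    (hγ : ∀ r a, γ r a = if (0 : Fin (K + 1)) ∉ a.2 then (if (κ r).succ ∉ a.2 then α r a.1 else β r a.1)
      else (if (κ r).succ ∉ a.2 then β' r a.1 else 0))
    {gbar : Fin m → Finset (Fin (K + 1)) → ℝ}
    (hg : ∀ r D, gbar r D = if (0 : Fin (K + 1)) ∉ D then (if (κ r).succ ∉ D then (1 : ℝ) else p)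
      else (if (κ r).succ ∉ D then q else 0))
    {Bset : Fin m → Finset (Fin (K + 1)) → Finset (Fin (K + 1))}
    (hB : ∀ r D, Bset r D = if (0 : Fin (K + 1)) ∉ D ∧ (κ r).succ ∉ D then D
      else insert (0 : Fin (K + 1)) (insert (κ r).succ D))
    {Ph : (Fin (K + 1) → S) × Finset (Fin (K + 1)) → (Fin (K + 1) → S) × Finset (Fin (K + 1)) → ℝ}
    (hPh : ∀ a b, Ph a b = ∑ r : Fin m, t / m *
        (γ r a * (if b.1 = edgeFlowSwap (φ r) 0 (κ r).succ a.1 ∧ b.2 = a.2.image (Equiv.swap (0 : Fin (K + 1)) (κ r).succ)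
            then (1 : ℝ) else 0)
          + (α r a.1 - γ r a) * (if b.1 = edgeFlowSwap (φ r) 0 (κ r).succ a.1 ∧ b.2 = Bset r a.2 then (1 : ℝ) else 0)
          + (1 - α r a.1) * (if b.1 = a.1 ∧ b.2 = Bset r a.2 then (1 : ℝ) else 0))
      + (1 - t) * ∑ k : Fin (K + 1), w k * (coordKernel M k a.1 b.1
          * (if b.2 = (if k = 0 then a.2.erase 0 else a.2) then (1 : ℝ) else 0)))
    {Q : Finset (Fin (K + 1)) → Finset (Fin (K + 1)) → ℝ}
    (hQ : ∀ D D', Q D D' = ∑ r : Fin m, t / m *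
        (gbar r D * (if D' = D.image (Equiv.swap (0 : Fin (K + 1)) (κ r).succ) then (1 : ℝ) else 0)
          + (1 - gbar r D) * (if D' = Bset r D then (1 : ℝ) else 0))
      + (1 - t) * (w 0 * (if D' = D.erase 0 then (1 : ℝ) else 0) + (1 - w 0) * (if D' = D then (1 : ℝ) else 0)))
    {Λ₀ : (Fin (K + 1) → S) × Finset (Fin (K + 1)) → ℝ}
    (hfresh : ∀ (z : Fin (K + 1) → S) (D : Finset (Fin (K + 1))) (j : Fin (K + 1)) (v : S), j ∉ D →
      Λ₀ (update z j v, D) * μ j (z j) = Λ₀ (z, D) * μ j v)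
    (n : ℕ) (D : Finset (Fin (K + 1))) :
    ∑ z : Fin (K + 1) → S, lawAt Ph Λ₀ n (z, D) = lawAt Q (fun D' => ∑ z : Fin (K + 1) → S, Λ₀ (z, D')) n D := by
  induction n generalizing D with
  | zero => rw [lawAt_zero, lawAt_zero]
  | succ n ih =>
    rw [lawAt_succ, lawAt_succ,
      dom_tag_step κ φ hμ hμ1 hM hw1 hβ hβ' hγ hg hB hPh hQ
        (dom_fresh_lawAt_of κ φ hμ hM0 hstat hα hβ hβ' hγ hB hPh hfresh n) D]
    unfold stepLaw
    exact sum_congr rfl fun D₁ _ => by rw [ih D₁]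

/-- **ON THE EMPTY STALE SET: `Λ_n(z, ∅) = (ν₀Qⁿ)(∅)·π̃(z)`** (fresh initial law of total mass one). [ours] -/
theorem dom_lawAt_empty_eq_of (hμ : ∀ k x, 0 < μ k x) (hμ1 : ∀ k, ∑ u, μ k u = 1) (hM : ∀ k, IsRowStochastic (M k))
    (hM0 : ∀ u v, M 0 u v = μ 0 v) (hstat : ∀ k : Fin (K + 1), k ≠ 0 → ∀ v, ∑ u, μ k u * M k u v = μ k v)
    (hw1 : ∑ k, w k = 1)
    {α : Fin m → (Fin (K + 1) → S) → ℝ}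
    (hα : ∀ r z, α r z = min 1 (tensorFun μ (edgeFlowSwap (φ r) 0 (κ r).succ z) / tensorFun μ z))
    {β : Fin m → (Fin (K + 1) → S) → ℝ} (hβ : ∀ r z, β r z = p * μ (κ r).succ (φ r (z 0)) / μ 0 (z 0))
    {β' : Fin m → (Fin (K + 1) → S) → ℝ}
    (hβ' : ∀ r z, β' r z = q * μ 0 ((φ r).symm (z (κ r).succ)) / μ (κ r).succ (z (κ r).succ))
    {γ : Fin m → (Fin (K + 1) → S) × Finset (Fin (K + 1)) → ℝ}
    (hγ : ∀ r a, γ r a = if (0 : Fin (K + 1)) ∉ a.2 then (if (κ r).succ ∉ a.2 then α r a.1 else β r a.1)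
      else (if (κ r).succ ∉ a.2 then β' r a.1 else 0))
    {gbar : Fin m → Finset (Fin (K + 1)) → ℝ}
    (hg : ∀ r D, gbar r D = if (0 : Fin (K + 1)) ∉ D then (if (κ r).succ ∉ D then (1 : ℝ) else p)
      else (if (κ r).succ ∉ D then q else 0))
    {Bset : Fin m → Finset (Fin (K + 1)) → Finset (Fin (K + 1))}
    (hB : ∀ r D, Bset r D = if (0 : Fin (K + 1)) ∉ D ∧ (κ r).succ ∉ D then D
      else insert (0 : Fin (K + 1)) (insert (κ r).succ D))
    {Ph : (Fin (K + 1) → S) × Finset (Fin (K + 1)) → (Fin (K + 1) → S) × Finset (Fin (K + 1)) → ℝ}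
    (hPh : ∀ a b, Ph a b = ∑ r : Fin m, t / m *
        (γ r a * (if b.1 = edgeFlowSwap (φ r) 0 (κ r).succ a.1 ∧ b.2 = a.2.image (Equiv.swap (0 : Fin (K + 1)) (κ r).succ)
            then (1 : ℝ) else 0)
          + (α r a.1 - γ r a) * (if b.1 = edgeFlowSwap (φ r) 0 (κ r).succ a.1 ∧ b.2 = Bset r a.2 then (1 : ℝ) else 0)
          + (1 - α r a.1) * (if b.1 = a.1 ∧ b.2 = Bset r a.2 then (1 : ℝ) else 0))
      + (1 - t) * ∑ k : Fin (K + 1), w k * (coordKernel M k a.1 b.1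
          * (if b.2 = (if k = 0 then a.2.erase 0 else a.2) then (1 : ℝ) else 0)))
    {Q : Finset (Fin (K + 1)) → Finset (Fin (K + 1)) → ℝ}
    (hQ : ∀ D D', Q D D' = ∑ r : Fin m, t / m *
        (gbar r D * (if D' = D.image (Equiv.swap (0 : Fin (K + 1)) (κ r).succ) then (1 : ℝ) else 0)
          + (1 - gbar r D) * (if D' = Bset r D then (1 : ℝ) else 0))
      + (1 - t) * (w 0 * (if D' = D.erase 0 then (1 : ℝ) else 0) + (1 - w 0) * (if D' = D then (1 : ℝ) else 0)))
    {Λ₀ : (Fin (K + 1) → S) × Finset (Fin (K + 1)) → ℝ}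
    (hfresh : ∀ (z : Fin (K + 1) → S) (D : Finset (Fin (K + 1))) (j : Fin (K + 1)) (v : S), j ∉ D →
      Λ₀ (update z j v, D) * μ j (z j) = Λ₀ (z, D) * μ j v)
    (n : ℕ) (z : Fin (K + 1) → S) :
    lawAt Ph Λ₀ n (z, ∅) = lawAt Q (fun D' => ∑ z : Fin (K + 1) → S, Λ₀ (z, D')) n ∅ * tensorFun μ z := by
  have hprop := fresh_empty_proportional_prod hμ (dom_fresh_lawAt_of κ φ hμ hM0 hstat hα hβ hβ' hγ hB hPh hfresh n)
  have hπ1 : ∑ z', tensorFun μ z' = 1 := sum_tensorFun_eq_one _ hμ1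
  have hsum : lawAt Ph Λ₀ n (z, ∅) * ∑ z', tensorFun μ z' = (∑ z', lawAt Ph Λ₀ n (z', ∅)) * tensorFun μ z := by
    rw [Finset.mul_sum, Finset.sum_mul]
    exact sum_congr rfl fun z' _ => hprop z z'
  rw [hπ1, mul_one, dom_lawAt_snd_of κ φ hμ hμ1 hM hM0 hstat hw1 hα hβ hβ' hγ hg hB hPh hQ hfresh n ∅] at hsum
  exact hsum

/-- **MINORISATION FROM A FRESH, NON-NEGATIVE INITIAL LAW: `(λ₀Pⁿ)(z) ≥ (ν₀Qⁿ)(∅)·π̃(z)`** under the two one-sided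
dominations (`0 ≤ p, q`). [ours] -/
theorem dom_minorization_of (hm : 1 ≤ m) (ht0 : 0 ≤ t) (ht1 : t ≤ 1) (hw0 : ∀ k, 0 ≤ w k) (hw1 : ∑ k, w k = 1)
    (hμ : ∀ k x, 0 < μ k x) (hμ1 : ∀ k, ∑ u, μ k u = 1) (hM : ∀ k, IsRowStochastic (M k))
    (hM0 : ∀ u v, M 0 u v = μ 0 v) (hstat : ∀ k : Fin (K + 1), k ≠ 0 → ∀ v, ∑ u, μ k u * M k u v = μ k v)
    (hp0 : 0 ≤ p) (hq0 : 0 ≤ q) (hdom : ∀ r u, p * μ (κ r).succ (φ r u) ≤ μ 0 u)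
    (hrev : ∀ r u, q * μ 0 u ≤ μ (κ r).succ (φ r u))
    {α : Fin m → (Fin (K + 1) → S) → ℝ}
    (hα : ∀ r z, α r z = min 1 (tensorFun μ (edgeFlowSwap (φ r) 0 (κ r).succ z) / tensorFun μ z))
    {β : Fin m → (Fin (K + 1) → S) → ℝ} (hβ : ∀ r z, β r z = p * μ (κ r).succ (φ r (z 0)) / μ 0 (z 0))
    {β' : Fin m → (Fin (K + 1) → S) → ℝ}
    (hβ' : ∀ r z, β' r z = q * μ 0 ((φ r).symm (z (κ r).succ)) / μ (κ r).succ (z (κ r).succ))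
    {γ : Fin m → (Fin (K + 1) → S) × Finset (Fin (K + 1)) → ℝ}
    (hγ : ∀ r a, γ r a = if (0 : Fin (K + 1)) ∉ a.2 then (if (κ r).succ ∉ a.2 then α r a.1 else β r a.1)
      else (if (κ r).succ ∉ a.2 then β' r a.1 else 0))
    {gbar : Fin m → Finset (Fin (K + 1)) → ℝ}
    (hg : ∀ r D, gbar r D = if (0 : Fin (K + 1)) ∉ D then (if (κ r).succ ∉ D then (1 : ℝ) else p)
      else (if (κ r).succ ∉ D then q else 0))
    {Bset : Fin m → Finset (Fin (K + 1)) → Finset (Fin (K + 1))}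
    (hB : ∀ r D, Bset r D = if (0 : Fin (K + 1)) ∉ D ∧ (κ r).succ ∉ D then D
      else insert (0 : Fin (K + 1)) (insert (κ r).succ D))
    {Ph : (Fin (K + 1) → S) × Finset (Fin (K + 1)) → (Fin (K + 1) → S) × Finset (Fin (K + 1)) → ℝ}
    (hPh : ∀ a b, Ph a b = ∑ r : Fin m, t / m *
        (γ r a * (if b.1 = edgeFlowSwap (φ r) 0 (κ r).succ a.1 ∧ b.2 = a.2.image (Equiv.swap (0 : Fin (K + 1)) (κ r).succ)
            then (1 : ℝ) else 0)
          + (α r a.1 - γ r a) * (if b.1 = edgeFlowSwap (φ r) 0 (κ r).succ a.1 ∧ b.2 = Bset r a.2 then (1 : ℝ) else 0)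
          + (1 - α r a.1) * (if b.1 = a.1 ∧ b.2 = Bset r a.2 then (1 : ℝ) else 0))
      + (1 - t) * ∑ k : Fin (K + 1), w k * (coordKernel M k a.1 b.1
          * (if b.2 = (if k = 0 then a.2.erase 0 else a.2) then (1 : ℝ) else 0)))
    {Q : Finset (Fin (K + 1)) → Finset (Fin (K + 1)) → ℝ}
    (hQ : ∀ D D', Q D D' = ∑ r : Fin m, t / m *
        (gbar r D * (if D' = D.image (Equiv.swap (0 : Fin (K + 1)) (κ r).succ) then (1 : ℝ) else 0)
          + (1 - gbar r D) * (if D' = Bset r D then (1 : ℝ) else 0))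
      + (1 - t) * (w 0 * (if D' = D.erase 0 then (1 : ℝ) else 0) + (1 - w 0) * (if D' = D then (1 : ℝ) else 0)))
    {Λ₀ : (Fin (K + 1) → S) × Finset (Fin (K + 1)) → ℝ}
    (hfresh : ∀ (z : Fin (K + 1) → S) (D : Finset (Fin (K + 1))) (j : Fin (K + 1)) (v : S), j ∉ D →
      Λ₀ (update z j v, D) * μ j (z j) = Λ₀ (z, D) * μ j v)
    (hΛ0 : ∀ a, 0 ≤ Λ₀ a) (n : ℕ) (z : Fin (K + 1) → S) :
    lawAt Q (fun D' => ∑ z : Fin (K + 1) → S, Λ₀ (z, D')) n ∅ * tensorFun μ z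
      ≤ lawAt (fun y z : Fin (K + 1) → S =>
          t * ptGraphSwap μ (fun r : Fin m => (((0 : Fin (K + 1)), (κ r).succ) : Fin (K + 1) × Fin (K + 1))) φ y z
          + (1 - t) * prodKernel w M y z) (fun z' => ∑ D, Λ₀ (z', D)) n z := by
  rw [← dom_lawAt_fst_of κ φ hm hμ hα hPh Λ₀ n z,
    ← dom_lawAt_empty_eq_of κ φ hμ hμ1 hM hM0 hstat hw1 hα hβ hβ' hγ hg hB hPh hQ hfresh n z]
  have hγα := goodWeight_le_accept κ φ hμ hp0 hq0 hα hβ hβ' hγ hdom hrev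
  have hnn : ∀ b, 0 ≤ lawAt Ph Λ₀ n b := fun b =>
    lawAt_nonneg (dom_aug_isRowStochastic κ φ hm ht0 ht1 hw0 hw1 hM hμ hα hγα hPh) hΛ0 n b
  exact Finset.single_le_sum (f := fun D => lawAt Ph Λ₀ n (z, D)) (fun D _ => hnn (z, D)) (mem_univ ∅)

/-- **THE FRESHNESS BOUND FROM A FRESH INITIAL LAW: `‖λ₀Pⁿ − π̃‖_TV ≤ Σ_{D≠∅}(ν₀Qⁿ)(D)`** (`Λ₀ ≥ 0`, `Σ Λ₀ = 1`,
`0 ≤ p, q ≤ 1`). [ours] -/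
theorem dom_tvDist_le_stale_of (hm : 1 ≤ m) (ht0 : 0 ≤ t) (ht1 : t ≤ 1) (hw0 : ∀ k, 0 ≤ w k) (hw1 : ∑ k, w k = 1)
    (hμ : ∀ k x, 0 < μ k x) (hμ1 : ∀ k, ∑ u, μ k u = 1) (hM : ∀ k, IsRowStochastic (M k))
    (hM0 : ∀ u v, M 0 u v = μ 0 v) (hstat : ∀ k : Fin (K + 1), k ≠ 0 → ∀ v, ∑ u, μ k u * M k u v = μ k v)
    (hp0 : 0 ≤ p) (hp1 : p ≤ 1) (hq0 : 0 ≤ q) (hq1 : q ≤ 1) (hdom : ∀ r u, p * μ (κ r).succ (φ r u) ≤ μ 0 u)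
    (hrev : ∀ r u, q * μ 0 u ≤ μ (κ r).succ (φ r u))
    {α : Fin m → (Fin (K + 1) → S) → ℝ}
    (hα : ∀ r z, α r z = min 1 (tensorFun μ (edgeFlowSwap (φ r) 0 (κ r).succ z) / tensorFun μ z))
    {β : Fin m → (Fin (K + 1) → S) → ℝ} (hβ : ∀ r z, β r z = p * μ (κ r).succ (φ r (z 0)) / μ 0 (z 0))
    {β' : Fin m → (Fin (K + 1) → S) → ℝ}
    (hβ' : ∀ r z, β' r z = q * μ 0 ((φ r).symm (z (κ r).succ)) / μ (κ r).succ (z (κ r).succ))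
    {γ : Fin m → (Fin (K + 1) → S) × Finset (Fin (K + 1)) → ℝ}
    (hγ : ∀ r a, γ r a = if (0 : Fin (K + 1)) ∉ a.2 then (if (κ r).succ ∉ a.2 then α r a.1 else β r a.1)
      else (if (κ r).succ ∉ a.2 then β' r a.1 else 0))
    {gbar : Fin m → Finset (Fin (K + 1)) → ℝ}
    (hg : ∀ r D, gbar r D = if (0 : Fin (K + 1)) ∉ D then (if (κ r).succ ∉ D then (1 : ℝ) else p)
      else (if (κ r).succ ∉ D then q else 0))
    {Bset : Fin m → Finset (Fin (K + 1)) → Finset (Fin (K + 1))}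
    (hB : ∀ r D, Bset r D = if (0 : Fin (K + 1)) ∉ D ∧ (κ r).succ ∉ D then D
      else insert (0 : Fin (K + 1)) (insert (κ r).succ D))
    {Ph : (Fin (K + 1) → S) × Finset (Fin (K + 1)) → (Fin (K + 1) → S) × Finset (Fin (K + 1)) → ℝ}
    (hPh : ∀ a b, Ph a b = ∑ r : Fin m, t / m *
        (γ r a * (if b.1 = edgeFlowSwap (φ r) 0 (κ r).succ a.1 ∧ b.2 = a.2.image (Equiv.swap (0 : Fin (K + 1)) (κ r).succ)
            then (1 : ℝ) else 0)
          + (α r a.1 - γ r a) * (if b.1 = edgeFlowSwap (φ r) 0 (κ r).succ a.1 ∧ b.2 = Bset r a.2 then (1 : ℝ) else 0)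
          + (1 - α r a.1) * (if b.1 = a.1 ∧ b.2 = Bset r a.2 then (1 : ℝ) else 0))
      + (1 - t) * ∑ k : Fin (K + 1), w k * (coordKernel M k a.1 b.1
          * (if b.2 = (if k = 0 then a.2.erase 0 else a.2) then (1 : ℝ) else 0)))
    {Q : Finset (Fin (K + 1)) → Finset (Fin (K + 1)) → ℝ}
    (hQ : ∀ D D', Q D D' = ∑ r : Fin m, t / m *
        (gbar r D * (if D' = D.image (Equiv.swap (0 : Fin (K + 1)) (κ r).succ) then (1 : ℝ) else 0)
          + (1 - gbar r D) * (if D' = Bset r D then (1 : ℝ) else 0))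
      + (1 - t) * (w 0 * (if D' = D.erase 0 then (1 : ℝ) else 0) + (1 - w 0) * (if D' = D then (1 : ℝ) else 0)))
    {Λ₀ : (Fin (K + 1) → S) × Finset (Fin (K + 1)) → ℝ}
    (hfresh : ∀ (z : Fin (K + 1) → S) (D : Finset (Fin (K + 1))) (j : Fin (K + 1)) (v : S), j ∉ D →
      Λ₀ (update z j v, D) * μ j (z j) = Λ₀ (z, D) * μ j v)
    (hΛ0 : ∀ a, 0 ≤ Λ₀ a) (hΛ1 : ∑ a, Λ₀ a = 1) (n : ℕ) :
    tvDist (lawAt (fun y z : Fin (K + 1) → S =>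
          t * ptGraphSwap μ (fun r : Fin m => (((0 : Fin (K + 1)), (κ r).succ) : Fin (K + 1) × Fin (K + 1))) φ y z
          + (1 - t) * prodKernel w M y z) (fun z' => ∑ D, Λ₀ (z', D)) n) (tensorFun μ)
      ≤ ∑ D ∈ univ.filter (fun D : Finset (Fin (K + 1)) => D ≠ ∅),
          lawAt Q (fun D' => ∑ z : Fin (K + 1) → S, Λ₀ (z, D')) n D := by
  have hP := weightedScheme_isRowStochastic (t := t) (w := w)
    (ptGraphSwap_isRowStochastic (e := fun r : Fin m => (((0 : Fin (K + 1)), (κ r).succ) : Fin (K + 1) × Fin (K + 1)))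
      (φ := φ) hμ) hM hw0 hw1 ht0 ht1
  have hw00 : 0 ≤ w 0 := hw0 0
  have hw01 : w 0 ≤ 1 := by
    have h := Finset.single_le_sum (f := w) (fun k _ => hw0 k) (mem_univ (0 : Fin (K + 1)))
    rw [hw1] at h; exact h
  have hQst := regen_isRowStochastic κ hm ht0 ht1 hw00 hw01 hp0 hp1 hq0 hq1 hg hQ
  have hν1 : ∑ D, ∑ z : Fin (K + 1) → S, Λ₀ (z, D) = 1 := by rw [← hΛ1, Fintype.sum_prod_type_right]
  have hlam1 : ∑ z : Fin (K + 1) → S, ∑ D, Λ₀ (z, D) = 1 := by rw [← hΛ1, Fintype.sum_prod_type]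
  have hmassQ : ∑ D, lawAt Q (fun D' => ∑ z : Fin (K + 1) → S, Λ₀ (z, D')) n D = 1 := by
    rw [sum_lawAt hQst]; exact hν1
  have hsplit := Finset.sum_filter_add_sum_filter_not univ (fun D : Finset (Fin (K + 1)) => D ≠ ∅)
    (fun D => lawAt Q (fun D' => ∑ z : Fin (K + 1) → S, Λ₀ (z, D')) n D)
  have hE : univ.filter (fun D : Finset (Fin (K + 1)) => ¬D ≠ ∅) = {∅} := by
    ext D; simp only [Finset.mem_filter, Finset.mem_univ, true_and, not_not, Finset.mem_singleton]
  rw [hmassQ, hE, Finset.sum_singleton] at hsplit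
  have htv := tvDist_le_of_pointwise_ge (fun z => (tensorFun_pos hμ z).le) (sum_tensorFun_eq_one _ hμ1)
    (by rw [sum_lawAt hP]; exact hlam1)
    (fun z => dom_minorization_of κ φ hm ht0 ht1 hw0 hw1 hμ hμ1 hM hM0 hstat hp0 hq0 hdom hrev hα hβ hβ' hγ hg hB hPh hQ
      hfresh hΛ0 n z)
  linarith

end Warm

end Summit.Ventures.LatticeQCDFlow.Scaling

end
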